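import Mathlib
import HarnessLib

/-!
# Peano's kernels for Gauss rules: the two-point rule worked out
# (Davis–Rabinowitz 1984, Sect. 4.3.1, (4.3.1.1)–(4.3.1.3))

**Source.** P. J. Davis, P. Rabinowitz, *Methods of Numerical Integration* (2nd ed., Academic Press, 1984),
Sect. 4.3.1 "Peano's Kernels for Gauss Rules".

**The text.** For `E(f) = ∫_{-1}^{1} w f − Σ_{k=1}^n w_k f(x_k)` exact on `𝒫_r`, the Peano kernel is
`K_r(t) = E_x[(x − t)_+^r]/r!`, i.e. `r! K_r(t) = ∫_{-1}^1 w(x)(x − t)^r dx − Σ_{x_k > t} w_k (x_k − t)^r` (4.3.1.1); for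
`w = 1`, `r! K_r(t) = (1 − t)^{r+1}/(r + 1) − Σ_{x_k > t} w_k (x_k − t)^r` (4.3.1.2). For the Gauss rule of order `n`
(exact for `𝒫_{2n−1}`) one has kernels of every order `r ≤ 2n − 1` and error estimates of type (4.3.11),
`|E(f)| ≤ e_r sup|f^{(r)}|` with `e_r = ∫_{-1}^1 |K_{r−1}(t)| dt` (4.3.1.3) (tabulated by Stroud–Secrest; e.g. `n = 10`,
`e_2 = .003859`); Stroud recommends these low-order estimates for integrands of low continuity.

**What is typed** (all PROVED, Mathlib only): the case `n = 2` (nodes `∓c`, `c = 1/√3 = √3/3`, weights `1, 1`) in full.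
* `g2c`, `g2c_sq : c² = 1/3`, bounds; `gauss2Kernel r t` = (4.3.1.2)`/r!` for `G_2`, and its three pieces
  (`gauss2Kernel_of_ge` for `t ≥ c`, `gauss2Kernel_of_mid` for `−c ≤ t < c`, `gauss2Kernel_of_lt` for `t < −c`);
* `gauss2Kernel_neg_one : K_r(−1) = 0` for `r ≤ 3` — this is `E((x + 1)^r) = 0`, the exactness of `G_2` on `𝒫_3`
  (and `gauss2Kernel_four_neg_one_ne : K_4(−1) ≠ 0`: not exact for degree 4);
* the top kernel `r = 3 = 2n − 1`: on the outer pieces `3! K_3(t) = (1 ∓ t)⁴/4` (`six_mul_gauss2Kernel_three_left`, the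
  identity `(1 − t)⁴/4 − (c − t)³ − (−c − t)³ = (1 + t)⁴/4` resting on `c² = 1/3`), it is even
  (`gauss2Kernel_three_even_mid`), and **`K_3 ≥ 0` on `[−1, 1]`** (`gauss2Kernel_three_nonneg`), so (4.3.13) applies:
  `E(f) = f⁽⁴⁾(ξ) ∫ K_3`;
* `integral_gauss2Kernel_three : ∫_{-1}^1 K_3 = 1/135` — recovering the classical `G_2` error constant
  `E_{G_2}(f) = f⁽⁴⁾(ξ)/135` ((2.7.11) with `n = 2`) — and the check `E(x⁴)/4! = (2/5 − 2/9)/24 = 1/135` (4.3.14)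
  (`gauss2_moment_four_defect`);
* the kernel of order 1 changes sign (`gauss2Kernel_one_zero_neg : K_1(0) < 0`, `gauss2Kernel_one_c_pos : K_1(c) > 0`), so
  for `r = 1` only the absolute estimate (4.3.11)/(4.3.1.3) is available, and `K_0` is the step function
  `(1 − t) − #{x_k > t}` (`gauss2Kernel_zero_mid : K_0(t) = −t` on the middle piece).

References: [cite: DavisRabinowitz1984, Sect. 4.3.1 (4.3.1.1)-(4.3.1.3)].
-/

noncomputable section

open Real MeasureTheory intervalIntegral Set

namespace Literature.Analysis.Quadrature

/-! ## The Gauss two-point node `c = 1/√3` -/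

/-- The positive Gauss–Legendre node for `n = 2`: `c = 1/√3 = √3/3`. [cite: DavisRabinowitz1984, Sect. 4.3.1] -/
def g2c : ℝ := Real.sqrt 3 / 3

/-- `c² = 1/3`. [cite: DavisRabinowitz1984, Sect. 4.3.1] -/
theorem g2c_sq : g2c ^ 2 = 1 / 3 := by
  unfold g2c
  rw [div_pow, Real.sq_sqrt (by norm_num)]
  norm_num

/-- `0 < c`. [cite: DavisRabinowitz1984, Sect. 4.3.1] -/
theorem g2c_pos : 0 < g2c := by unfold g2c; positivity

/-- `0.577 < c < 0.578`. [cite: DavisRabinowitz1984, Sect. 4.3.1] -/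
theorem g2c_bounds : 0.577 < g2c ∧ g2c < 0.578 := by
  have h := g2c_sq
  have h0 := g2c_pos
  constructor <;> nlinarith

/-- `c < 1`: the nodes are interior. [cite: DavisRabinowitz1984, Sect. 4.3.1] -/
theorem g2c_lt_one : g2c < 1 := by linarith [g2c_bounds.2]

/-- `c = 1/√3`. [cite: DavisRabinowitz1984, Sect. 4.3.1] -/
theorem g2c_eq_inv_sqrt : g2c = 1 / Real.sqrt 3 := by
  unfold g2c
  have h3 : Real.sqrt 3 ≠ 0 := by positivity
  rw [div_eq_div_iff (by norm_num) h3]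
  nlinarith [Real.mul_self_sqrt (show (0 : ℝ) ≤ 3 by norm_num)]

/-! ## (4.3.1.2) for `G_2` -/

/-- The Peano kernel of order `r` of the Gauss two-point rule on `[−1, 1]` (`w = 1`, weights `1, 1`, nodes `∓c`):
`K_r(t) = [(1 − t)^{r+1}/(r+1) − Σ_{x_k > t} (x_k − t)^r]/r!` (4.3.1.2). [cite: DavisRabinowitz1984, Sect. 4.3.1 (4.3.1.2)] -/
def gauss2Kernel (r : ℕ) (t : ℝ) : ℝ :=
  ((1 - t) ^ (r + 1) / (r + 1) -
      ((if t < -g2c then (-g2c - t) ^ r else 0) + (if t < g2c then (g2c - t) ^ r else 0))) / r.factorial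

/-- Right piece `t ≥ c`: no node exceeds `t`. [cite: DavisRabinowitz1984, Sect. 4.3.1 (4.3.1.2)] -/
theorem gauss2Kernel_of_ge {r : ℕ} {t : ℝ} (ht : g2c ≤ t) :
    gauss2Kernel r t = (1 - t) ^ (r + 1) / (r + 1) / r.factorial := by
  unfold gauss2Kernel
  have h1 : ¬ t < -g2c := by linarith [g2c_pos]
  have h2 : ¬ t < g2c := not_lt.mpr ht
  simp [h1, h2]

/-- Middle piece `−c ≤ t < c`: only the node `+c` exceeds `t`. [cite: DavisRabinowitz1984, Sect. 4.3.1 (4.3.1.2)] -/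
theorem gauss2Kernel_of_mid {r : ℕ} {t : ℝ} (h1 : -g2c ≤ t) (h2 : t < g2c) :
    gauss2Kernel r t = ((1 - t) ^ (r + 1) / (r + 1) - (g2c - t) ^ r) / r.factorial := by
  unfold gauss2Kernel
  have h1' : ¬ t < -g2c := not_lt.mpr h1
  simp [h1', h2]

/-- Left piece `t < −c`: both nodes exceed `t`. [cite: DavisRabinowitz1984, Sect. 4.3.1 (4.3.1.2)] -/
theorem gauss2Kernel_of_lt {r : ℕ} {t : ℝ} (h : t < -g2c) :
    gauss2Kernel r t = ((1 - t) ^ (r + 1) / (r + 1) - ((-g2c - t) ^ r + (g2c - t) ^ r)) / r.factorial := by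
  unfold gauss2Kernel
  have h2 : t < g2c := by linarith [g2c_pos]
  simp [h, h2]

/-! ## `K_r(−1) = E((x+1)^r)/r! = 0` for `r ≤ 3`: exactness of `G_2` on `𝒫_3` -/

/-- `K_r(−1) = 0` for `r = 0, 1, 2, 3` (the rule is exact for `(x + 1)^r`, `r ≤ 3`), using `c² = 1/3`.
[cite: DavisRabinowitz1984, Sect. 4.3.1 (4.3.1.2)] -/
theorem gauss2Kernel_neg_one {r : ℕ} (hr : r ≤ 3) : gauss2Kernel r (-1) = 0 := by
  have hlt : (-1 : ℝ) < -g2c := by linarith [g2c_lt_one]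
  rw [gauss2Kernel_of_lt hlt]
  have hc := g2c_sq
  interval_cases r <;> norm_num <;> nlinarith [hc]

/-- … but `K_4(−1) = E((x+1)⁴)/4! ≠ 0`: `G_2` is not exact for degree 4.
[cite: DavisRabinowitz1984, Sect. 4.3.1 (4.3.1.2)] -/
theorem gauss2Kernel_four_neg_one_ne : gauss2Kernel 4 (-1) ≠ 0 := by
  have hlt : (-1 : ℝ) < -g2c := by linarith [g2c_lt_one]
  rw [gauss2Kernel_of_lt hlt]
  have hc := g2c_sq
  have h4 : g2c ^ 4 = 1 / 9 := by nlinarith [hc]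
  norm_num [Nat.factorial]
  intro h
  nlinarith [hc, h4, h]

/-! ## The top kernel `K_3` -/

/-- Left piece of `K_3`: `3! K_3(t) = (1 + t)⁴/4` for `t < −c` (the two cubes combine through `c² = 1/3`).
[cite: DavisRabinowitz1984, Sect. 4.3.1 (4.3.1.2)] -/
theorem six_mul_gauss2Kernel_three_left {t : ℝ} (h : t < -g2c) : 6 * gauss2Kernel 3 t = (1 + t) ^ 4 / 4 := by
  rw [gauss2Kernel_of_lt h]
  have hc := g2c_sq
  norm_num [Nat.factorial]
  linear_combination (6 * t) * hc

/-- Right piece of `K_3`: `3! K_3(t) = (1 − t)⁴/4` for `t ≥ c`. [cite: DavisRabinowitz1984, Sect. 4.3.1 (4.3.1.2)] -/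
theorem six_mul_gauss2Kernel_three_right {t : ℝ} (h : g2c ≤ t) : 6 * gauss2Kernel 3 t = (1 - t) ^ 4 / 4 := by
  rw [gauss2Kernel_of_ge h]
  norm_num [Nat.factorial]
  ring

/-- Middle piece of `K_3`: `3! K_3(t) = (1 − t)⁴/4 − (c − t)³` for `−c ≤ t < c`.
[cite: DavisRabinowitz1984, Sect. 4.3.1 (4.3.1.2)] -/
theorem six_mul_gauss2Kernel_three_mid {t : ℝ} (h1 : -g2c ≤ t) (h2 : t < g2c) :
    6 * gauss2Kernel 3 t = (1 - t) ^ 4 / 4 - (g2c - t) ^ 3 := by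
  rw [gauss2Kernel_of_mid h1 h2]
  norm_num [Nat.factorial]
  ring

/-- `K_3` is even on the middle piece: `(1 − t)⁴/4 − (c − t)³ = (1 + t)⁴/4 − (c + t)³` (again `c² = 1/3`).
[cite: DavisRabinowitz1984, Sect. 4.3.1 (4.3.1.2)] -/
theorem gauss2Kernel_three_even_mid (t : ℝ) :
    (1 - t) ^ 4 / 4 - (g2c - t) ^ 3 = (1 + t) ^ 4 / 4 - (g2c + t) ^ 3 := by
  have hc := g2c_sq
  linear_combination (6 * t) * hc

/-- The key inequality on the middle piece: `(c − t)³ ≤ (1 − t)⁴/4` for `0 ≤ t ≤ c`.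
[cite: DavisRabinowitz1984, Sect. 4.3.1 (4.3.1.2)] -/
theorem gauss2_cube_le_quartic {t : ℝ} (ht0 : 0 ≤ t) (htc : t ≤ g2c) : (g2c - t) ^ 3 ≤ (1 - t) ^ 4 / 4 := by
  have hc := g2c_sq
  obtain ⟨hc0, hc1⟩ := g2c_bounds
  nlinarith [mul_nonneg ht0 (sub_nonneg.2 htc), sq_nonneg (g2c - t), sq_nonneg (1 - t), sq_nonneg t,
    mul_nonneg (mul_nonneg ht0 ht0) (sub_nonneg.2 htc), pow_pos (sub_pos.2 (show t < 1 by linarith)) 4]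

/-- **`K_3 ≥ 0` on `[−1, 1]`** — the kernel of the top order does not change sign, so (4.3.13) gives
`E_{G_2}(f) = f⁽⁴⁾(ξ) ∫ K_3`. [cite: DavisRabinowitz1984, Sect. 4.3.1 (4.3.1.2)] -/
theorem gauss2Kernel_three_nonneg (t : ℝ) : 0 ≤ gauss2Kernel 3 t := by
  suffices h : 0 ≤ 6 * gauss2Kernel 3 t by linarith
  rcases lt_or_ge t (-g2c) with h | h
  · rw [six_mul_gauss2Kernel_three_left h]; positivity
  rcases lt_or_ge t g2c with h' | h'
  · rw [six_mul_gauss2Kernel_three_mid h h']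
    rcases le_or_gt 0 t with h0 | h0
    · linarith [gauss2_cube_le_quartic h0 h'.le]
    · rw [gauss2Kernel_three_even_mid]
      have := gauss2_cube_le_quartic (t := -t) (by linarith) (by linarith)
      have e1 : (g2c - -t) = g2c + t := by ring
      have e2 : (1 - -t) = 1 + t := by ring
      rw [e1, e2] at this
      linarith
  · rw [six_mul_gauss2Kernel_three_right h']; positivity

/-! ## `∫_{-1}^{1} K_3 = 1/135`: the `G_2` error constant -/

/-- `K_3` as an explicit piecewise polynomial (for integration). [cite: DavisRabinowitz1984, Sect. 4.3.1 (4.3.1.2)] -/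
theorem gauss2Kernel_three_eq (t : ℝ) :
    gauss2Kernel 3 t = ((1 - t) ^ 4 / 4 -
      ((if t < -g2c then (-g2c - t) ^ 3 else 0) + (if t < g2c then (g2c - t) ^ 3 else 0))) / 6 := by
  unfold gauss2Kernel; norm_num [Nat.factorial]

/-- `∫_{-1}^{1} (x_k − t)_+^3 dt = (x_k + 1)⁴/4` for a node `x_k ∈ [−1, 1]`.
[cite: DavisRabinowitz1984, Sect. 4.3.1 (4.3.1.1)] -/
theorem integral_truncCube (x : ℝ) (hx1 : -1 ≤ x) (hx2 : x ≤ 1) :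
    ∫ t in (-1 : ℝ)..1, (if t < x then (x - t) ^ 3 else 0) = (x + 1) ^ 4 / 4 := by
  have hsplit : ∫ t in (-1 : ℝ)..1, (if t < x then (x - t) ^ 3 else 0) =
      (∫ t in (-1 : ℝ)..x, (if t < x then (x - t) ^ 3 else 0)) + ∫ t in x..1, (if t < x then (x - t) ^ 3 else 0) := by
    rw [integral_add_adjacent_intervals]
    · exact (intervalIntegrable_iff_integrableOn_Icc_of_le hx1).mpr
        ((Continuous.integrableOn_Icc (by fun_prop : Continuous fun t : ℝ => (x - t) ^ 3)).congr_fun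
          (fun t ht => by
            by_cases h : t < x
            · simp [h]
            · have : t = x := le_antisymm ht.2 (not_lt.mp h)
              simp [this]) measurableSet_Icc)
    · exact (intervalIntegrable_iff_integrableOn_Icc_of_le hx2).mpr
        ((integrableOn_zero).congr_fun (fun t ht => by simp [not_lt.mpr ht.1]) measurableSet_Icc)
  rw [hsplit]
  have h1 : ∫ t in (-1 : ℝ)..x, (if t < x then (x - t) ^ 3 else 0) = ∫ t in (-1 : ℝ)..x, (x - t) ^ 3 := by
    refine integral_congr_ae (Filter.Eventually.of_forall fun t ht => ?_)
    rw [uIoc_of_le hx1] at ht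
    rcases ht.2.lt_or_eq with h | h
    · simp [h]
    · simp [h]
  have h2 : ∫ t in x..1, (if t < x then (x - t) ^ 3 else 0) = ∫ t in x..1, (0 : ℝ) := by
    refine integral_congr_ae (Filter.Eventually.of_forall fun t ht => ?_)
    rw [uIoc_of_le hx2] at ht
    simp [not_lt.mpr ht.1.le]
  rw [h1, h2, intervalIntegral.integral_zero, add_zero]
  have h3 : ∫ t in (-1 : ℝ)..x, (x - t) ^ 3 = (x + 1) ^ 4 / 4 := by
    rw [show (fun t => (x - t) ^ 3) = fun t => (x - t) ^ 3 from rfl]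
    have := integral_comp_sub_left (fun u : ℝ => u ^ 3) x (a := -1) (b := x)
    rw [this, integral_pow]
    ring
  exact h3

/-- **`∫_{-1}^{1} K_3(t) dt = 1/135`**: `E_{G_2}(f) = f⁽⁴⁾(ξ)/135`, the classical error constant of the Gauss
two-point rule ((2.7.11), `n = 2`), recovered through (4.3.13). [cite: DavisRabinowitz1984, Sect. 4.3.1 (4.3.1.2)] -/
theorem integral_gauss2Kernel_three : ∫ t in (-1 : ℝ)..1, gauss2Kernel 3 t = 1 / 135 := by
  simp_rw [gauss2Kernel_three_eq]
  obtain ⟨hc0, hc1⟩ := g2c_bounds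
  have hcn1 : -1 ≤ -g2c := by linarith
  have hcn2 : -g2c ≤ 1 := by linarith
  have hcp1 : -1 ≤ g2c := by linarith
  have hcp2 : g2c ≤ 1 := by linarith
  have hA : IntervalIntegrable (fun t : ℝ => (1 - t) ^ 4 / 4) volume (-1) 1 :=
    Continuous.intervalIntegrable (by fun_prop) _ _
  have hB1 : IntervalIntegrable (fun t : ℝ => if t < -g2c then (-g2c - t) ^ 3 else 0) volume (-1) 1 := by
    refine (intervalIntegrable_iff_integrableOn_Icc_of_le (by norm_num)).mpr ?_
    refine Integrable.mono' ((Continuous.integrableOn_Icc (by fun_prop : Continuous fun t : ℝ => |(-g2c - t)| ^ 3)))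
      ?_ (Filter.Eventually.of_forall fun t => ?_)
    · refine Measurable.aestronglyMeasurable ?_
      exact Measurable.ite measurableSet_Iio (by fun_prop) (by fun_prop)
    · by_cases h : t < -g2c
      · simp [h, abs_of_pos (show 0 < -g2c - t by linarith)]
      · simp [h]
  have hB2 : IntervalIntegrable (fun t : ℝ => if t < g2c then (g2c - t) ^ 3 else 0) volume (-1) 1 := by
    refine (intervalIntegrable_iff_integrableOn_Icc_of_le (by norm_num)).mpr ?_
    refine Integrable.mono' ((Continuous.integrableOn_Icc (by fun_prop : Continuous fun t : ℝ => |(g2c - t)| ^ 3)))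
      ?_ (Filter.Eventually.of_forall fun t => ?_)
    · refine Measurable.aestronglyMeasurable ?_
      exact Measurable.ite measurableSet_Iio (by fun_prop) (by fun_prop)
    · by_cases h : t < g2c
      · simp [h, abs_of_pos (show 0 < g2c - t by linarith)]
      · simp [h]
  rw [intervalIntegral.integral_div, intervalIntegral.integral_sub hA (hB1.add hB2),
    intervalIntegral.integral_add hB1 hB2, integral_truncCube _ hcn1 hcn2, integral_truncCube _ hcp1 hcp2]
  have hq : ∫ t in (-1 : ℝ)..1, (1 - t) ^ 4 / 4 = 8 / 5 := by
    have := integral_comp_sub_left (fun u : ℝ => u ^ 4 / 4) (1 : ℝ) (a := -1) (b := 1)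
    rw [this, intervalIntegral.integral_div, integral_pow]
    norm_num
  rw [hq]
  have hc := g2c_sq
  have h4 : g2c ^ 4 = 1 / 9 := by nlinarith [hc]
  nlinarith [hc, h4]

/-- The same constant from (4.3.14): `∫ K_3 = E(x⁴)/4! = (∫_{-1}^1 x⁴ − 2c⁴)/24 = (2/5 − 2/9)/24 = 1/135`.
[cite: DavisRabinowitz1984, Sect. 4.3.1] -/
theorem gauss2_moment_four_defect : ((∫ x in (-1 : ℝ)..1, x ^ 4) - ((-g2c) ^ 4 + g2c ^ 4)) / 24 = 1 / 135 := by
  rw [integral_pow]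
  have h4 : g2c ^ 4 = 1 / 9 := by nlinarith [g2c_sq]
  have h4' : (-g2c) ^ 4 = 1 / 9 := by rw [neg_pow]; norm_num [h4]
  rw [h4, h4']
  norm_num

/-! ## Lower orders: `K_1` changes sign, `K_0` is a step function -/

/-- `K_1(0) = (1 − 2c)/2 < 0`. [cite: DavisRabinowitz1984, Sect. 4.3.1 (4.3.1.3)] -/
theorem gauss2Kernel_one_zero_neg : gauss2Kernel 1 0 < 0 := by
  rw [gauss2Kernel_of_mid (by linarith [g2c_pos]) g2c_pos]
  obtain ⟨hc0, -⟩ := g2c_bounds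
  norm_num [Nat.factorial]
  linarith

/-- `K_1(c) = (1 − c)²/2 > 0`: `K_1` changes sign, so for `r = 1` only the absolute estimate
`|E f| ≤ e_2 sup|f''|` (4.3.11), (4.3.1.3) is available. [cite: DavisRabinowitz1984, Sect. 4.3.1 (4.3.1.3)] -/
theorem gauss2Kernel_one_c_pos : 0 < gauss2Kernel 1 g2c := by
  rw [gauss2Kernel_of_ge le_rfl]
  have := g2c_lt_one
  norm_num [Nat.factorial]
  nlinarith [mul_pos (sub_pos.2 this) (sub_pos.2 this)]

/-- `K_0(t) = (1 − t) − #{x_k > t}`; on the middle piece `K_0(t) = −t`. [cite: DavisRabinowitz1984, Sect. 4.3.1 (4.3.1.2)] -/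
theorem gauss2Kernel_zero_mid {t : ℝ} (h1 : -g2c ≤ t) (h2 : t < g2c) : gauss2Kernel 0 t = -t := by
  rw [gauss2Kernel_of_mid h1 h2]
  norm_num [Nat.factorial]

end Literature.Analysis.Quadrature

end
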